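import Mathlib
import Literature.NumberTheory.Transcendental.KZCalculusProofs
import Literature.NumberTheory.Transcendental.KZLogCalculusProofs
import Literature.NumberTheory.Transcendental.SemialgebraicMapsProofs
import Literature.NumberTheory.Transcendental.KZSemialgebraicComplex
import Literature.NumberTheory.Transcendental.KZIdealTetrahedron
import Summits.KontsevichZagierPeriods.KontsevichZagierPeriods.Theorems.HyperbolicBlochOffTetraSectorKernelStubSimilarityMove
import Summits.KontsevichZagierPeriods.KontsevichZagierPeriods.Theorems.HyperbolicBlochOffTetraSectorKernelStubLadderTransfer

/-!
# `OffTetraSectorKernel`, line `odd-hyperbolic-ladder`: rung `0` closes unconditionally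

Stub `interval_log_relation_mem_relations` of the crux `OffTetraSectorKernel`
(stmt-KontsevichZagierPeriods-10557, route HyperbolicBloch). Rung `0` of Goncharov's hyperbolic
scissors ladder is the hyperbolic line `ℍ¹ = {t > 0} ⊆ ℝ¹` with the rational length density
`dt/t`; its `ℚ̄`-polytopes are the intervals `{α < t < β}` with real-algebraic end points, of
length `log (β/α)`. We prove, with NO transcendence input, that every `ℤ`-linear relation
`Σ mᵢ log (βᵢ/αᵢ) = 0` among such lengths is a Kontsevich–Zagier relation among the integral
representations `[{αᵢ < t < βᵢ}, dt/t]`: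

* exponentiating, the relation is the EXACT multiplicative relation `∏ qᵢ^{mᵢ⁺} = ∏ qᵢ^{mᵢ⁻}`
  (`qᵢ = βᵢ/αᵢ ≥ 1`, `mᵢ = mᵢ⁺ − mᵢ⁻`);
* the dilation `t ↦ c t` (`c > 0` real-algebraic) is one change-of-variables move
  (`stub_similarityMove` at `n = 0`), so `[{α<t<β}, dt/t] ~ [{1<t<β/α}, dt/t] =: L (β/α)`;
* cutting `(1, q q')` at `q` (rule (1a) modulo the null point `{t = q}`,
  `ladderTransfer_of_sub_two_mem_relations`) and dilating `(q, q q')` onto `(1, q')` gives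
  `[L (q q')] − [L q] − [L q'] ∈ KZ.relations`, and `L 1` (empty domain) is a relation;
* hence `[L (∏ qᵢ^{eᵢ})] − Σ eᵢ • [L qᵢ] ∈ KZ.relations`, and the exact relation finishes.

No new definitions: a family `L` of canonical representations `[{1 < t < q}, dt/t]` is obtained
by choice from an existence lemma and carried as a hypothesis of the bookkeeping lemmas.

References: A. B. Goncharov, *Volumes of hyperbolic manifolds and mixed Tate motives* (1999),
§1.7; M. Kontsevich, D. Zagier, *Periods* (2001), §1.2; R. Benedetti, C. Petronio, *Lectures on
Hyperbolic Geometry* (1992), A.3.5.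
-/

noncomputable section

open Set MeasureTheory MvPolynomial
open Literature.NumberTheory.Transcendental Literature.ModelTheory.ExponentialFields

namespace Summit.KontsevichZagierPeriods.HyperbolicBloch.OffTetraSectorKernel

/-- The open interval `{a < t < b} ⊆ ℝ¹` with real-algebraic end points is `ℚ`-semialgebraic.
[cite: BochnakCosteRoy1998, Prop. 2.2.6] -/
theorem isSemialgebraic_logIvl {a b : ℝ} (ha : IsAlgebraic ℚ a) (hb : IsAlgebraic ℚ b) :
    IsSemialgebraic ℚ {p : Fin 1 → ℝ | a < p 0 ∧ p 0 < b} := by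
  have hU : IsSemialgebraic ℚ (univ : Set (Fin 1 → ℝ)) := isSemialgebraic_univ
  have hc : IsSemialgebraicFunOn ℚ (univ : Set (Fin 1 → ℝ)) (fun p => p 0) :=
    (isSemialgebraicFunOn_aeval hU (X 0)).congr fun p _ => by simp
  have h1 : IsSemialgebraic ℚ {p : Fin 1 → ℝ | a < p 0} :=
    isSemialgebraic_setOf_lt_of_isSemialgebraicFunOn
      (isSemialgebraicFunOn_const_of_isAlgebraic hU ha) hc
  have h2 : IsSemialgebraic ℚ {p : Fin 1 → ℝ | p 0 < b} :=
    isSemialgebraic_setOf_lt_of_isSemialgebraicFunOn hc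
      (isSemialgebraicFunOn_const_of_isAlgebraic hU hb)
  have h : {p : Fin 1 → ℝ | a < p 0 ∧ p 0 < b} = {p : Fin 1 → ℝ | a < p 0} ∩ {p | p 0 < b} := by
    ext p; simp
  rw [h]
  exact h1.inter h2

/-- Existence of the representation `[{a < t < b}, dt/t]` for real-algebraic `0 < a`, `b`: the
domain is `ℚ`-semialgebraic, `1/t` is a rational function with non-vanishing denominator there,
and it is continuous on the compact interval `[a, b]`. [cite: KontsevichZagier2001, §1.1] -/
theorem exists_logRep {a b : ℝ} (ha0 : 0 < a) (ha : IsAlgebraic ℚ a) (hb : IsAlgebraic ℚ b) :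
    ∃ R : KZ.IntegralRep 1, R.domain = {p : Fin 1 → ℝ | a < p 0 ∧ p 0 < b} ∧
      R.integrand = fun p : Fin 1 → ℝ => 1 / p 0 := by
  have hs := isSemialgebraic_logIvl ha hb
  have hq : ∀ p ∈ {p : Fin 1 → ℝ | a < p 0 ∧ p 0 < b},
      aeval p (X 0 : MvPolynomial (Fin 1) ℚ) ≠ 0 :=
    fun p hp => by simpa using (ha0.trans hp.1).ne'
  have hf : IsSemialgebraicFunOn ℚ {p : Fin 1 → ℝ | a < p 0 ∧ p 0 < b}
      (fun p : Fin 1 → ℝ => 1 / p 0) :=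
    (isSemialgebraicFunOn_aeval_div_aeval hs 1 (X 0) hq).congr fun p _ => by simp
  have hint : IntegrableOn (fun p : Fin 1 → ℝ => 1 / p 0)
      {p : Fin 1 → ℝ | a < p 0 ∧ p 0 < b} := by
    have h1 : IntegrableOn (fun t : ℝ => 1 / t) (Ioo a b) := by
      have hc : ContinuousOn (fun t : ℝ => 1 / t) (Icc a b) :=
        (continuousOn_const.div continuousOn_id) fun t ht => (ha0.trans_le ht.1).ne'
      exact (hc.integrableOn_compact isCompact_Icc).mono_set Ioo_subset_Icc_self
    have h2 : IntegrableOn (fun p : Fin 1 → ℝ => (fun t : ℝ => 1 / t) (p 0))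
        {p : Fin 1 → ℝ | p 0 ∈ Ioo a b} :=
      ((volume_preserving_funUnique (Fin 1) ℝ).integrableOn_comp_preimage
        (MeasurableEquiv.funUnique (Fin 1) ℝ).measurableEmbedding).2 h1
    simpa using h2
  exact ⟨⟨{p : Fin 1 → ℝ | a < p 0 ∧ p 0 < b}, fun p => 1 / p 0, hs, hf, hint⟩, rfl, rfl⟩

/-- A representation with domain `{a < t < b}`, `b ≤ a`, has empty domain, hence is a relation.
[cite: KontsevichZagier2001, §1.2] -/
theorem of_mem_relations_of_logIvl_of_le {a b : ℝ} {R : KZ.IntegralRep 1}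
    (hd : R.domain = {p : Fin 1 → ℝ | a < p 0 ∧ p 0 < b}) (hba : b ≤ a) :
    KZ.of R ∈ KZ.relations := by
  refine KZ.of_mem_relations_of_volume_eq_zero R ?_
  have h : R.domain = ∅ := by
    rw [hd]
    ext p
    simp only [mem_setOf_eq, mem_empty_iff_false, iff_false, not_and, not_lt]
    intro h
    linarith
  rw [h, measure_empty]

/-- **Dilation.** For real-algebraic `c > 0` the dilation `t ↦ c t` (the boundary similarity of
`ℍ¹` with trivial boundary part) carries `[{a < t < b}, dt/t]` to `[{ca < t < cb}, dt/t]` by one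
change-of-variables move (`stub_similarityMove` at `n = 0`). [cite: BenedettiPetronio1992, A.3.5] -/
theorem of_sub_of_mem_relations_of_logIvl_dilate {a b c : ℝ} {R R' : KZ.IntegralRep 1}
    (ha : 0 ≤ a) (hc0 : 0 < c) (hc : IsAlgebraic ℚ c)
    (hd : R.domain = {p : Fin 1 → ℝ | a < p 0 ∧ p 0 < b})
    (hi : EqOn R.integrand (fun p : Fin 1 → ℝ => 1 / p 0) R.domain)
    (hd' : R'.domain = {p : Fin 1 → ℝ | c * a < p 0 ∧ p 0 < c * b})
    (hi' : EqOn R'.integrand (fun p : Fin 1 → ℝ => 1 / p 0) R'.domain) :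
    KZ.of R - KZ.of R' ∈ KZ.relations := by
  have hmap : ∀ p : Fin 1 → ℝ, (Fin.snoc (α := fun _ => ℝ)
      (c • (1 : Matrix (Fin 0) (Fin 0) ℝ).mulVec (Fin.init p) + (0 : Fin 0 → ℝ))
      (c * p (Fin.last 0)) : Fin 1 → ℝ) = fun _ => c * p 0 := fun p => by
    ext i
    obtain rfl : i = Fin.last 0 := Subsingleton.elim (α := Fin 1) _ _
    simp
  refine stub_similarityMove 0 c 1 0 hc hc0 (fun i => i.elim0) (by simp) (fun i => i.elim0) R R'
    ?_ ?_ ?_ ?_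
  · rw [hd]
    intro p hp
    exact ha.trans_lt hp.1
  · intro p hp
    rw [hi hp]
    simp
  · rw [hd', hd]
    ext p
    simp only [mem_setOf_eq, mem_image, hmap]
    constructor
    · rintro ⟨h1, h2⟩
      refine ⟨fun _ => p 0 / c, ⟨?_, ?_⟩, ?_⟩
      · rw [lt_div_iff₀ hc0]; linarith
      · rw [div_lt_iff₀ hc0]; linarith
      · ext i
        obtain rfl : i = 0 := Subsingleton.elim (α := Fin 1) _ _
        field_simp
    · rintro ⟨q, ⟨h1, h2⟩, rfl⟩
      exact ⟨by nlinarith, by nlinarith⟩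
  · intro p hp
    rw [hi' hp]
    simp

/-- **Dissection.** Cutting `(a, b)` at `q ∈ [a, b]`: `[{a<t<b}, dt/t] − [{a<t<q}, dt/t] −
[{q<t<b}, dt/t] ∈ KZ.relations` (rule (1a) modulo the null point `{t = q}`).
[cite: KontsevichZagier2001, §1.2] -/
theorem of_sub_sub_mem_relations_of_logIvl_split {a q b : ℝ} {R R₁ R₂ : KZ.IntegralRep 1}
    (haq : a ≤ q) (hqb : q ≤ b) (hd : R.domain = {p : Fin 1 → ℝ | a < p 0 ∧ p 0 < b})
    (hi : EqOn R.integrand (fun p : Fin 1 → ℝ => 1 / p 0) R.domain)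
    (hd₁ : R₁.domain = {p : Fin 1 → ℝ | a < p 0 ∧ p 0 < q})
    (hi₁ : EqOn R₁.integrand (fun p : Fin 1 → ℝ => 1 / p 0) R₁.domain)
    (hd₂ : R₂.domain = {p : Fin 1 → ℝ | q < p 0 ∧ p 0 < b})
    (hi₂ : EqOn R₂.integrand (fun p : Fin 1 → ℝ => 1 / p 0) R₂.domain) :
    KZ.of R - KZ.of R₁ - KZ.of R₂ ∈ KZ.relations := by
  have hs₁ : R₁.domain ⊆ R.domain := by
    rw [hd₁, hd]
    exact fun p hp => ⟨hp.1, hp.2.trans_le hqb⟩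
  have hs₂ : R₂.domain ⊆ R.domain := by
    rw [hd₂, hd]
    exact fun p hp => ⟨haq.trans_lt hp.1, hp.2⟩
  refine ladderTransfer_of_sub_two_mem_relations R R₁ R₂ hs₁ hs₂
    (fun p hp => (hi₁ hp).trans (hi (hs₁ hp)).symm)
    (fun p hp => (hi₂ hp).trans (hi (hs₂ hp)).symm) ?_ ?_
  · have h : R₁.domain ∩ R₂.domain = ∅ := by
      rw [hd₁, hd₂]
      ext p
      simp only [mem_inter_iff, mem_setOf_eq, mem_empty_iff_false, iff_false, not_and, not_lt,
        and_imp]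
      intro _ h2 h3
      linarith
    rw [h, measure_empty]
  · refine measure_mono_null (fun p hp => ?_) (KZ.volume_setOf_last_eq_zero (n := 0) q)
    rw [hd, hd₁, hd₂] at hp
    simp only [mem_sdiff, mem_setOf_eq, mem_union, not_or, not_and, not_lt] at hp
    obtain ⟨⟨h1, h2⟩, h3, h4⟩ := hp
    show p 0 = q
    have h5 := h3 h1
    rcases h5.lt_or_eq with h5 | h5
    · exact absurd h2 (not_lt.2 (h4 h5))
    · exact h5.symm

/-! ### The multiplicative bookkeeping `q ↦ L q = [{1 < t < q}, dt/t]` -/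

/-- There is a family `L : ℝ → KZ.IntegralRep 1` with `L q = [{1 < t < q}, dt/t]` for every
real-algebraic `q` (choice applied to `exists_logRep`). [cite: KontsevichZagier2001, §1.1] -/
theorem exists_logFamily : ∃ L : ℝ → KZ.IntegralRep 1, ∀ q : ℝ, IsAlgebraic ℚ q →
    (L q).domain = {p : Fin 1 → ℝ | 1 < p 0 ∧ p 0 < q} ∧
      EqOn (L q).integrand (fun p : Fin 1 → ℝ => 1 / p 0) (L q).domain := by
  have h : ∀ q : ℝ, ∃ R : KZ.IntegralRep 1, IsAlgebraic ℚ q →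
      R.domain = {p : Fin 1 → ℝ | 1 < p 0 ∧ p 0 < q} ∧
        R.integrand = fun p : Fin 1 → ℝ => 1 / p 0 := fun q => by
    by_cases hq : IsAlgebraic ℚ q
    · obtain ⟨R, hR⟩ := exists_logRep one_pos isAlgebraic_one hq
      exact ⟨R, fun _ => hR⟩
    · obtain ⟨R, -⟩ := exists_logRep (b := 1) one_pos isAlgebraic_one isAlgebraic_one
      exact ⟨R, fun h => absurd h hq⟩
  choose L hL using h
  exact ⟨L, fun q hq => ⟨(hL q hq).1, fun p _ => by rw [(hL q hq).2]⟩⟩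

/-- **Multiplicativity modulo moves**: `[L (q q')] − [L q] − [L q'] ∈ KZ.relations` for
real-algebraic `q, q' ≥ 1` (dissect `(1, q q')` at `q`, then dilate `(q, q q')` by `1/q` onto
`(1, q')`). [cite: KontsevichZagier2001, §1.2] -/
theorem logFamily_mul (L : ℝ → KZ.IntegralRep 1) (hL : ∀ q : ℝ, IsAlgebraic ℚ q →
      (L q).domain = {p : Fin 1 → ℝ | 1 < p 0 ∧ p 0 < q} ∧
        EqOn (L q).integrand (fun p : Fin 1 → ℝ => 1 / p 0) (L q).domain)
    {q q' : ℝ} (h1q : 1 ≤ q) (h1q' : 1 ≤ q') (hq : IsAlgebraic ℚ q) (hq' : IsAlgebraic ℚ q') :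
    KZ.of (L (q * q')) - KZ.of (L q) - KZ.of (L q') ∈ KZ.relations := by
  have hq0 : 0 < q := by linarith
  obtain ⟨R₂, hd₂, hi₂⟩ := exists_logRep (b := q * q') hq0 hq (hq.mul hq')
  have hsplit := of_sub_sub_mem_relations_of_logIvl_split h1q
    (le_mul_of_one_le_right hq0.le h1q') (hL _ (hq.mul hq')).1 (hL _ (hq.mul hq')).2
    (hL q hq).1 (hL q hq).2 hd₂ (fun p _ => by rw [hi₂])
  have hdil := of_sub_of_mem_relations_of_logIvl_dilate (a := 1) (b := q') (c := q) zero_le_one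
    hq0 hq (hL q' hq').1 (hL q' hq').2 (by rw [hd₂, mul_one]) (fun p _ => by rw [hi₂])
  have h := KZ.relations.sub_mem hsplit hdil
  convert h using 1
  abel

/-- `[L (q ^ e)] − e • [L q] ∈ KZ.relations` for real-algebraic `q ≥ 1`.
[cite: KontsevichZagier2001, §1.2] -/
theorem logFamily_pow (L : ℝ → KZ.IntegralRep 1) (hL : ∀ q : ℝ, IsAlgebraic ℚ q →
      (L q).domain = {p : Fin 1 → ℝ | 1 < p 0 ∧ p 0 < q} ∧
        EqOn (L q).integrand (fun p : Fin 1 → ℝ => 1 / p 0) (L q).domain)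
    {q : ℝ} (h1q : 1 ≤ q) (hq : IsAlgebraic ℚ q) (e : ℕ) :
    KZ.of (L (q ^ e)) - e • KZ.of (L q) ∈ KZ.relations := by
  induction e with
  | zero =>
    rw [pow_zero, zero_smul, sub_zero]
    exact of_mem_relations_of_logIvl_of_le (hL 1 isAlgebraic_one).1 le_rfl
  | succ e ih =>
    have hmul := logFamily_mul L hL (one_le_pow₀ h1q) h1q (hq.pow e) hq
    rw [pow_succ, succ_nsmul]
    have h := KZ.relations.add_mem hmul ih
    convert h using 1
    abel

/-- Finite products of real-algebraic numbers are real-algebraic. [folklore] -/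
theorem isAlgebraic_finset_prod_real {ι : Type*} (s : Finset ι) {f : ι → ℝ}
    (hf : ∀ i ∈ s, IsAlgebraic ℚ (f i)) : IsAlgebraic ℚ (∏ i ∈ s, f i) :=
  isAlgebraic_iff_isIntegral.2
    (IsIntegral.prod f fun i hi => isAlgebraic_iff_isIntegral.1 (hf i hi))

/-- `[L (∏ qᵢ ^ eᵢ)] − Σ eᵢ • [L qᵢ] ∈ KZ.relations` for real-algebraic `qᵢ ≥ 1`.
[cite: KontsevichZagier2001, §1.2] -/
theorem logFamily_prod_pow (L : ℝ → KZ.IntegralRep 1) (hL : ∀ q : ℝ, IsAlgebraic ℚ q →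
      (L q).domain = {p : Fin 1 → ℝ | 1 < p 0 ∧ p 0 < q} ∧
        EqOn (L q).integrand (fun p : Fin 1 → ℝ => 1 / p 0) (L q).domain)
    {ι : Type*} (s : Finset ι) {q : ι → ℝ} (e : ι → ℕ)
    (h1q : ∀ i ∈ s, 1 ≤ q i) (hq : ∀ i ∈ s, IsAlgebraic ℚ (q i)) :
    KZ.of (L (∏ i ∈ s, q i ^ e i)) - ∑ i ∈ s, e i • KZ.of (L (q i)) ∈ KZ.relations := by
  classical
  induction s using Finset.induction_on with
  | empty =>
    rw [Finset.prod_empty, Finset.sum_empty, sub_zero]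
    exact of_mem_relations_of_logIvl_of_le (hL 1 isAlgebraic_one).1 le_rfl
  | insert a s ha ih =>
    have h1 : 1 ≤ q a := h1q a (Finset.mem_insert_self a s)
    have hqa : IsAlgebraic ℚ (q a) := hq a (Finset.mem_insert_self a s)
    have h1' : ∀ i ∈ s, 1 ≤ q i := fun i hi => h1q i (Finset.mem_insert_of_mem hi)
    have hq' : ∀ i ∈ s, IsAlgebraic ℚ (q i) := fun i hi => hq i (Finset.mem_insert_of_mem hi)
    have hP1 : 1 ≤ ∏ i ∈ s, q i ^ e i := Finset.one_le_prod fun i hi => one_le_pow₀ (h1' i hi)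
    have hPalg : IsAlgebraic ℚ (∏ i ∈ s, q i ^ e i) :=
      isAlgebraic_finset_prod_real s fun i hi => (hq' i hi).pow _
    rw [Finset.prod_insert ha, Finset.sum_insert ha]
    have hmul := logFamily_mul L hL (q := q a ^ e a) (q' := ∏ i ∈ s, q i ^ e i)
      (one_le_pow₀ h1) hP1 (hqa.pow (e a)) hPalg
    have hpow := logFamily_pow L hL h1 hqa (e a)
    have h := KZ.relations.add_mem (KZ.relations.add_mem hmul hpow) (ih h1' hq')
    convert h using 1
    abel

/-- **Rung `0` of the hyperbolic scissors ladder closes unconditionally.** A `ℤ`-linear relation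
`Σ mᵢ log (βᵢ/αᵢ) = 0` among hyperbolic lengths of `ℚ̄`-intervals `{αᵢ < t < βᵢ} ⊆ ℍ¹` is a
Kontsevich–Zagier relation among the representations `[{αᵢ < t < βᵢ}, dt/t]`: exponentiating
gives the EXACT relation `∏ qᵢ^{mᵢ⁺} = ∏ qᵢ^{mᵢ⁻}` (`qᵢ = βᵢ/αᵢ`), and the map `q ↦ [L q]` is
multiplicative modulo dissections and dilations. [cite: Goncharov1999, §1.7] -/
theorem interval_log_relation_mem_relations : ∀ (k : ℕ) (α β : Fin k → ℝ) (m : Fin k → ℤ) (r : Fin k → Literature.NumberTheory.Transcendental.KZ.IntegralRep 1), (∀ i, 0 < α i) → (∀ i, α i ≤ β i) → (∀ i, IsAlgebraic ℚ (α i)) → (∀ i, IsAlgebraic ℚ (β i)) → (∀ i, (r i).domain = {p : Fin 1 → ℝ | α i < p 0 ∧ p 0 < β i} ∧ Set.EqOn (r i).integrand (fun p : Fin 1 → ℝ => 1 / p 0) (r i).domain) → ∑ i, (m i : ℝ) * Real.log (β i / α i) = 0 → ∑ i, m i • Literature.NumberTheory.Transcendental.KZ.of (r i) ∈ Literature.NumberTheory.Transcendental.KZ.relations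 := by
  intro k α β m r hα hαβ halgα halgβ hr hlog
  obtain ⟨L, hL⟩ := exists_logFamily
  have hq1 : ∀ i, 1 ≤ β i / α i := fun i => (one_le_div (hα i)).2 (hαβ i)
  have hq0 : ∀ i, 0 < β i / α i := fun i => one_pos.trans_le (hq1 i)
  have hqalg : ∀ i, IsAlgebraic ℚ (β i / α i) := fun i => (halgβ i).mul (halgα i).inv
  -- (0) the exact multiplicative relation `∏ qᵢ ^ mᵢ⁺ = ∏ qᵢ ^ mᵢ⁻`
  have hm : ∀ i, (m i : ℝ) = ((m i).toNat : ℝ) - ((-m i).toNat : ℝ) := fun i => by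
    have h := congrArg (fun z : ℤ => (z : ℝ)) (Int.toNat_sub_toNat_neg (m i))
    simp only [Int.cast_sub, Int.cast_natCast] at h
    exact h.symm
  have hlog' : ∑ i, ((m i).toNat : ℝ) * Real.log (β i / α i) =
      ∑ i, ((-m i).toNat : ℝ) * Real.log (β i / α i) := by
    rw [← sub_eq_zero, ← Finset.sum_sub_distrib, ← hlog]
    refine Finset.sum_congr rfl fun i _ => ?_
    rw [← sub_mul, hm i]
  have hprod : ∏ i, (β i / α i) ^ (m i).toNat = ∏ i, (β i / α i) ^ (-m i).toNat := by
    have h : Real.log (∏ i, (β i / α i) ^ (m i).toNat) =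
        Real.log (∏ i, (β i / α i) ^ (-m i).toNat) := by
      rw [Real.log_prod fun i _ => (pow_pos (hq0 i) _).ne',
        Real.log_prod fun i _ => (pow_pos (hq0 i) _).ne']
      simp only [Real.log_pow]
      exact hlog'
    exact Real.log_injOn_pos (Set.mem_Ioi.2 (Finset.prod_pos fun i _ => pow_pos (hq0 i) _))
      (Set.mem_Ioi.2 (Finset.prod_pos fun i _ => pow_pos (hq0 i) _)) h
  -- (1) bookkeeping: `Σ mᵢ • [L qᵢ] ∈ relations`
  have hp : KZ.of (L (∏ i, (β i / α i) ^ (m i).toNat)) -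
      ∑ i, (m i).toNat • KZ.of (L (β i / α i)) ∈ KZ.relations :=
    logFamily_prod_pow L hL Finset.univ (fun i => (m i).toNat) (fun i _ => hq1 i)
      (fun i _ => hqalg i)
  have hn : KZ.of (L (∏ i, (β i / α i) ^ (-m i).toNat)) -
      ∑ i, (-m i).toNat • KZ.of (L (β i / α i)) ∈ KZ.relations :=
    logFamily_prod_pow L hL Finset.univ (fun i => (-m i).toNat) (fun i _ => hq1 i)
      (fun i _ => hqalg i)
  rw [hprod] at hp
  have hLsum : ∑ i, m i • KZ.of (L (β i / α i)) ∈ KZ.relations := by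
    have h := KZ.relations.sub_mem hn hp
    have e : ∑ i, m i • KZ.of (L (β i / α i)) =
        ∑ i, (m i).toNat • KZ.of (L (β i / α i)) - ∑ i, (-m i).toNat • KZ.of (L (β i / α i)) := by
      rw [← Finset.sum_sub_distrib]
      refine Finset.sum_congr rfl fun i _ => ?_
      calc m i • KZ.of (L (β i / α i))
          = (((m i).toNat : ℤ) - ((-m i).toNat : ℤ)) • KZ.of (L (β i / α i)) := by
            rw [Int.toNat_sub_toNat_neg]
        _ = _ := by rw [sub_zsmul, natCast_zsmul, natCast_zsmul, ← sub_eq_add_neg]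
    rw [e]
    convert h using 1
    abel
  -- (2) transport: `[rᵢ] − [L qᵢ] ∈ relations` by the dilation `t ↦ t / αᵢ`
  have hT : ∀ i, KZ.of (r i) - KZ.of (L (β i / α i)) ∈ KZ.relations := fun i => by
    refine of_sub_of_mem_relations_of_logIvl_dilate (a := α i) (b := β i) (c := (α i)⁻¹)
      (hα i).le (inv_pos.2 (hα i)) (halgα i).inv (hr i).1 (hr i).2 ?_ (hL _ (hqalg i)).2
    rw [(hL _ (hqalg i)).1, inv_mul_cancel₀ (hα i).ne', ← div_eq_inv_mul]
  have e : ∑ i, m i • KZ.of (r i) = ∑ i, m i • (KZ.of (r i) - KZ.of (L (β i / α i))) +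
      ∑ i, m i • KZ.of (L (β i / α i)) := by
    rw [← Finset.sum_add_distrib]
    refine Finset.sum_congr rfl fun i _ => ?_
    rw [zsmul_sub, sub_add_cancel]
  rw [e]
  exact KZ.relations.add_mem (sum_mem fun i _ => KZ.relations.zsmul_mem (hT i) _) hLsum

end Summit.KontsevichZagierPeriods.HyperbolicBloch.OffTetraSectorKernel

end
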